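import Literature.AnabelianGeometry.EtaleTheta.Discharge.Sec2Prop24ModelCharacteristic
import HarnessLib

/-!
# [EtTh] Theorem 1.6 (i), leaves L02 / L05: the unconditional halves of the printed characterisations
# `KerToZIsCompactlyGenerated` (R1) and `GtpYNFromCusp` (R2) over the root interface

Mochizuki, *The étale theta function …*, Publ. RIMS **45** (2009), §1 p. 12 ("the universal
graph-covering of the dual graph of this special fiber determines … a natural surjection `Π^tp_X ↠ Z`
whose kernel … `Π^tp_Y`"), p. 13 (the construction of `Y_N`), and the proof of Thm. 1.6 (i) p. 24
("immediate from the definitions; the discreteness of the topological group “Z”")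
[cite: MochizukiEtTh2009, §1 p.12] [cite: MochizukiEtTh2009, Thm 1.6 (i) p.24].

abc-iut cell, layer L2, sub-DAG `plan/L2/SUBDAG-EtTh-Thm16.md` (holder abc-iut-L6-d5), seat
abc-iut-w5-d051 (L2-lead 03:24:22Z (b): "the L05/L02 carrier lemmas"). abc-iut-L6-d5's statements file
(p418133) types two printed characterisations the root `ThetaSetting` does not carry:
`Thm16Sub.KerToZIsCompactlyGenerated D` (`Π^tp_Y =` the closed subgroup topologically generated by the
compact subgroups of `Π^tp_X`) and `Thm16Sub.GtpYNFromCusp D N` (the cusp-section construction of `Y_N`).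
PROVED here (theorems only; plain topological group theory over the root axioms):

* `Thm16Sub.continuous_toZ` — `Π^tp_X ↠ Z` is continuous ("the discreteness of Z": its kernel is open,
  root field `isOpen_ker_toZ`);
* `Thm16Sub.mem_GtpY_of_pow_mem` — `Z` is torsion-free; and **`Thm16Sub.kerToZIsCompactlyGenerated_iff`**:
  with abc-iut-L6-d6's `ThetaSetting.closure_compact_le_GtpY` (Sec2Prop24ModelCharacteristic.lean: EVERY
  compact subgroup of `Π^tp_X` lies in `Π^tp_Y`, so the closed subgroup they topologically generate lies in
  `Π^tp_Y` UNCONDITIONALLY) the R1 statement is equivalent to the single inclusion `Π^tp_Y ≤` that closed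
  subgroup — the genuinely geometric half ([SemiAnbd] Thm 3.7 (iv): `Π^tp_Y` is generated by the (compact)
  decomposition groups of the irreducible components), which is what an origin clause has to supply;
* `Thm16Sub.mem_GtpY_of_mem_GtpYN`, `Thm16Sub.aug_mem_GKN_of_mem_GtpYN` — two of the three conjuncts of
  the forward direction of `GtpYNFromCusp` hold over the root (`GtpYN_le`, `map_aug_GtpYN`); hence
  **`Thm16Sub.gtpYNFromCusp_iff`**: R2 is equivalent to its genuine content (the ell-image clause for
  members of `Π^tp_{Y_N}` and the converse).

HONEST FRAMING: [EtTh] is refereed and undisputed; nothing is asserted; typed ≠ proved; nothing here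
bears on [IUTchIII] Cor. 3.12.
-/

noncomputable section

namespace Literature.AnabelianGeometry.EtaleTheta

open Literature.AnabelianGeometry.SemiGraphs Topology

namespace Thm16Sub

variable {p : ℕ} [Fact p.Prime] (D : ThetaSetting p)

/-! ### L02: compact subgroups die in `Z` -/

/-- "The discreteness of the topological group `Z`" (proof of Thm. 1.6 (i), p. 24): `Π^tp_X ↠ Z` is
continuous for the discrete topology on `Z` (its kernel `Π^tp_Y` is open). [cite: MochizukiEtTh2009, Thm 1.6 (i) p.24] -/
theorem continuous_toZ : Continuous D.toZ := by
  refine continuous_def.2 fun s _ => ?_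
  have hs : D.toZ ⁻¹' s = ⋃ g ∈ D.toZ ⁻¹' s, (fun x => g⁻¹ * x) ⁻¹' (D.toZ.ker : Set D.PiTemp) := by
    ext x
    simp only [Set.mem_preimage, Set.mem_iUnion, SetLike.mem_coe, MonoidHom.mem_ker, map_mul, map_inv,
      exists_prop]
    constructor
    · intro hx
      exact ⟨x, hx, by rw [inv_mul_cancel]⟩
    · rintro ⟨g, hg, hgx⟩
      rw [inv_mul_eq_one] at hgx
      rwa [← hgx]
  rw [hs]
  exact isOpen_biUnion fun g _ => D.isOpen_ker_toZ.preimage (continuous_const_mul g⁻¹)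

/-- `Z ≅ ℤ` is torsion-free: an element of `Π^tp_X` some positive power of which lies in `Π^tp_Y` lies
in `Π^tp_Y`. [cite: MochizukiEtTh2009, §1 p.12] -/
theorem mem_GtpY_of_pow_mem {x : D.PiTemp} {n : ℕ} (hn : 0 < n) (hx : x ^ n ∈ D.GtpY) : x ∈ D.GtpY := by
  change x ^ n ∈ D.toZ.ker at hx
  change x ∈ D.toZ.ker
  rw [MonoidHom.mem_ker] at hx ⊢
  rw [map_pow] at hx
  have h : n • Multiplicative.toAdd (D.toZ x) = 0 := by
    rw [← toAdd_pow, hx, toAdd_one]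
  rcases smul_eq_zero.mp h with h0 | h0
  · exact absurd h0 hn.ne'
  · rw [← ofAdd_toAdd (D.toZ x), h0, ofAdd_zero]

/-- **R1 reduced to one inclusion.** `KerToZIsCompactlyGenerated D` holds iff `Π^tp_Y` is contained in
the closed subgroup topologically generated by the compact subgroups of `Π^tp_X` — the geometric half
("the universal graph-covering of the dual graph … determines … `Π^tp_X ↠ Z`", p. 12; [SemiAnbd] Thm 3.7
(iv): `Π^tp_Y` is generated by the decomposition groups of the irreducible components, which are compact).
[cite: MochizukiEtTh2009, §1 p.12] -/
theorem kerToZIsCompactlyGenerated_iff :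
    KerToZIsCompactlyGenerated D ↔ D.GtpY ≤
      (Subgroup.closure
        {g : D.PiTemp | ∃ C : Subgroup D.PiTemp, IsCompact (C : Set D.PiTemp) ∧ g ∈ C}).topologicalClosure :=
  ⟨fun h => h.le, fun h => le_antisymm h D.closure_compact_le_GtpY⟩

/-! ### L05: the root's share of the cusp-section characterisation of `Π^tp_{Y_N}` -/

/-- `Π^tp_{Y_N} ⊆ Π^tp_Y` (root field `GtpYN_le`). [cite: MochizukiEtTh2009, §1 p.13] -/
theorem mem_GtpY_of_mem_GtpYN (N : ℕ+) {g : D.PiTemp} (hg : g ∈ D.GtpYN N) : g ∈ D.GtpY :=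
  D.GtpYN_le N hg

/-- `aug(Π^tp_{Y_N}) = G_{K_N}` (root field `map_aug_GtpYN`): members of `Π^tp_{Y_N}` map to `G_{K_N}`.
[cite: MochizukiEtTh2009, §1 p.13] -/
theorem aug_mem_GKN_of_mem_GtpYN (N : ℕ+) {g : D.PiTemp} (hg : g ∈ D.GtpYN N) : D.aug g ∈ D.GKN N := by
  have h : D.aug.toMonoidHom g ∈ (D.GtpYN N).map D.aug.toMonoidHom := ⟨g, hg, rfl⟩
  rw [D.map_aug_GtpYN] at h
  exact h

/-- **R2 reduced to its genuine content.** `GtpYNFromCusp D N` holds iff, for every cuspidal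
decomposition group `Dc ⊆ Π^tp_Y`: (→) every `g ∈ Π^tp_{Y_N}` has ell-image in
`(Dc ∩ aug⁻¹G_{K_N})^ell · N·(Δ^tp_Y)^ell`, and (←) every `g ∈ Π^tp_Y` over `G_{K_N}` with such an
ell-image lies in `Π^tp_{Y_N}` — the two conjuncts `g ∈ Π^tp_Y`, `aug g ∈ G_{K_N}` of the printed
characterisation being automatic over the root. [cite: MochizukiEtTh2009, §1 p.13] -/
theorem gtpYNFromCusp_iff (N : ℕ+) :
    GtpYNFromCusp D N ↔ ∀ Dc : Subgroup D.PiTemp, D.IsCuspidalDecompositionGroup Dc → Dc ≤ D.GtpY →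
      (∀ g ∈ D.GtpYN N,
        toEll D g ∈ ((Dc ⊓ (D.GKN N).comap D.aug.toMonoidHom).map (toEll D)) ⊔ ellPowersY D N) ∧
      ∀ g ∈ D.GtpY, D.aug g ∈ D.GKN N →
        toEll D g ∈ ((Dc ⊓ (D.GKN N).comap D.aug.toMonoidHom).map (toEll D)) ⊔ ellPowersY D N →
          g ∈ D.GtpYN N := by
  constructor
  · intro h Dc hDc hDcY
    refine ⟨fun g hg => ((h Dc hDc hDcY g).mp hg).2.2, fun g hgY hgK hgT => (h Dc hDc hDcY g).mpr ⟨hgY, hgK, hgT⟩⟩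
  · intro h Dc hDc hDcY g
    obtain ⟨h₁, h₂⟩ := h Dc hDc hDcY
    exact ⟨fun hg => ⟨mem_GtpY_of_mem_GtpYN D N hg, aug_mem_GKN_of_mem_GtpYN D N hg, h₁ g hg⟩,
      fun ⟨hgY, hgK, hgT⟩ => h₂ g hgY hgK hgT⟩

end Thm16Sub

end Literature.AnabelianGeometry.EtaleTheta

end
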